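import Summits.BirchSwinnertonDyer.BirchSwinnertonDyer.Theorems.TameQuarticSolventTprimePsiThreeRootsAtThree
import Summits.BirchSwinnertonDyer.Rank1Residual.Additive.FouquetWanLocus
import Literature.NumberTheory.EllipticCurves.ModThreeReducibleIffPsi3Root
import HarnessLib

/-!
# Route `TameQuarticSolvent`, crux `SolventPairLowerBound` (stmt-BirchSwinnertonDyer-21391) — the LOCAL
# IRREDUCIBILITY of `E[3]` at `3` on the (t′) leaf is DECIDED by `ord₃ c₆`:
# `LocIrr W 3 ⟺ c₆ = 0 ∨ 2·ord₃ c₆ ≠ ord₃ Δ + 3` (= case B of the Hodge split)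

HONEST FRAMING. Theorems only; helper (`--supports stmt-BirchSwinnertonDyer-21391 --as helper`) of width seat
bsd-wall-tqs-p1-w3 g5 — the kernel form of the main claim of the memo
`Cruxes/SolventPairLowerBound/TPRIME-LOCAL-SHAPE-w3g5.md` (census: 15 316 / 15 316 curves). `LocIrr W 3`
(`Rank1Residual/Additive/FouquetWanLocus.lean`: `E[3]|G_{ℚ₃}` irreducible, i.e. `(W ⊗ ℚ₃).HasIrreducibleModPGaloisRep 3`)
is the local hypothesis (i) of Fouquet–Wan 2021 Thm. 1.7 / 5.1 carried by the FW-locus stubs of routes KT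
(19981 `stub_lower_fwLocus`) and K9; on the (t′) leaf it is now read off the Kraus invariants of the minimal model.
BSD is not proved by any of this; nothing here closes 21391 / 19981.

WHAT. `tprime_locIrr_three_iff` — for `W/ℚ` globally minimal, elliptic, `Addv W 3`, `SubTprime W 3`:
`LocIrr W 3 ↔ (W.c₆ = 0 ∨ 2 * ord₃ c₆ ≠ ord₃ Δ + 3)`; i.e. `E[3]|G_{ℚ₃}` is REDUCIBLE exactly in CASE A
(`ord₃ Δ = 3 ∧ ord₃ c₆ = 3`, or `ord₃ Δ = 9 ∧ ord₃ c₆ = 6`: Hodge height `1/2`, canonical subgroup) and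
IRREDUCIBLE exactly in CASE B (`ord₃ c₆ ≥ 5`, resp. `≥ 8`, or `j = 1728`). Proof: Cremona's criterion
(`hasIrreducibleModPGaloisRep_three_iff_forall_not_isRoot_Ψ₃`: reducible iff `Ψ₃` has a `ℚ₃`-root), transport
of roots along `W ⊗ ℚ₃ = (T⁻¹) • (medium form)` (`eval_Ψ₃_smul`), and the root count on the medium form
(`tprime_caseA_exists_eval_Ψ₃_eq_zero_padic`, `tprime_caseB_forall_eval_Ψ₃_ne_zero`, `…_IIIstar`).
Also the two one-sided readings `not_locIrr_three_of_caseA`-shape / `locIrr_three_of_caseB`-shape as corollaries.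

References: J. E. Cremona, *Algorithms for Modular Elliptic Curves* §3.8; O. Fouquet, X. Wan, arXiv:2107.13726
Thm. 1.7 (hypothesis on `ρ̄|G_{ℚ_p}`); N. M. Katz, LNM 350 §3.1. [cite: Cremona1997, §3.8]
[cite: SilvermanAEC2009, Exercise 3.7]
-/

-- D-0017: single-problem summit, so `Summit.BirchSwinnertonDyer.BirchSwinnertonDyer.…` repeats a namespace BY DESIGN.
set_option linter.dupNamespace false

noncomputable section

open IsLocalRing IsDedekindDomain Polynomial
open IsDiscreteValuationRing hiding maximalIdeal
open Literature Literature.NumberTheory.DiophantineGeometry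
  Literature.NumberTheory.DiophantineGeometry.TateAlgorithm
  Literature.NumberTheory.EllipticCurves Literature.NumberTheory.EllipticCurves.Rizzo
  Literature.NumberTheory.EllipticCurves.Rank1Residual
  Summit.BirchSwinnertonDyer.Rank1Residual.Additive

namespace Summit.BirchSwinnertonDyer.BirchSwinnertonDyer.Theorems.SolventPairLowerBound

section Transport

variable {F : Type*} [Field F]

/-- **Roots of `Ψ₃` along a change of variables.** `Ψ₃^{C•W}` has a root in `F` iff `Ψ₃^{W}` has one
(`x ↦ u²x + r`; the `u⁸`-law `eval_Ψ₃_smul`). [cite: SilvermanAEC2009, III.1 and Exercise 3.7] -/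
theorem exists_eval_Ψ₃_eq_zero_smul_iff (C : WeierstrassCurve.VariableChange F) (W : WeierstrassCurve F) :
    (∃ x : F, (C • W).Ψ₃.eval x = 0) ↔ ∃ x : F, W.Ψ₃.eval x = 0 := by
  constructor
  · rintro ⟨x, hx⟩
    refine ⟨(C.u : F) ^ 2 * x + C.r, ?_⟩
    rw [eval_Ψ₃_smul] at hx
    exact (mul_eq_zero.mp hx).resolve_left (pow_ne_zero _ (Units.ne_zero _))
  · rintro ⟨x, hx⟩
    have h : C⁻¹ • (C • W) = W := inv_smul_smul C W
    refine ⟨((C⁻¹).u : F) ^ 2 * x + (C⁻¹).r, ?_⟩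
    have hx' : (C⁻¹ • (C • W)).Ψ₃.eval x = 0 := by rw [h]; exact hx
    rw [eval_Ψ₃_smul] at hx'
    exact (mul_eq_zero.mp hx').resolve_left (pow_ne_zero _ (Units.ne_zero _))

end Transport

section RatLevel

variable (W : WeierstrassCurve ℚ) [W.IsElliptic] [W.IsGloballyMinimal]

/-- **`LocIrr W 3` on the (t′) leaf is decided by `ord₃ c₆`.** For `W/ℚ` globally minimal, elliptic, `Addv W 3`,
`SubTprime W 3`: `E[3]|G_{ℚ₃}` is irreducible iff `c₆ = 0 ∨ 2·ord₃ c₆ ≠ ord₃ Δ + 3` (case B of the Hodge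
split: `ord₃ c₆ ≥ 5` for `III`, `≥ 8` for `III*`, or `j = 1728`); equivalently it is REDUCIBLE iff
`ord₃ Δ = 3 ∧ ord₃ c₆ = 3` or `ord₃ Δ = 9 ∧ ord₃ c₆ = 6` (case A: Hodge height `1/2`, the canonical subgroup
is a `G_{ℚ₃}`-stable line). Census (TPRIME-LOCAL-SHAPE-w3g5): case A 6 605 / case B 1 058 classes
(`N < 5·10⁵`); `Ψ₃` has a `ℚ₃`-root on 13 935 / 13 935 A-curves and on 0 / 1 381 B-curves.
[cite: Cremona1997, §3.8] [cite: SilvermanATAEC1994, IV.9.4 and Table 4.1] -/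
theorem tprime_locIrr_three_iff (hadd : Addv W 3) (hsub : SubTprime W 3) :
    LocIrr W 3 ↔ (W.c₆ = 0 ∨ 2 * padicValRat 3 W.c₆ ≠ padicValRat 3 W.Δ + 3) := by
  classical
  obtain ⟨T, V, hVmap, hA₁, hA₃, hcases⟩ := exists_padicInt_mediumForm_of_subTprime W hadd hsub
  have h2 : IsUnit (2 : ℤ_[3]) := isUnit_two_padicInt_three
  have h3i : Irreducible (3 : ℤ_[3]) := by simpa using PadicInt.irreducible_p (p := 3)
  set S := T • V with hS
  set ι := algebraMap ℤ_[3] ℚ_[3] with hι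
  -- transport of valuations from `S` to `W` (as in `tprime_padicValRat_c₆_split`)
  have haddu : addVal ℤ_[3] ((T.u⁻¹ : ℤ_[3]ˣ) : ℤ_[3]) = 0 :=
    addVal_def ((T.u⁻¹ : ℤ_[3]ˣ) : ℤ_[3]) T.u⁻¹ h3i 0 (by rw [pow_zero, mul_one])
  have hSΔ : S.Δ = ((T.u⁻¹ : ℤ_[3]ˣ) : ℤ_[3]) ^ 12 * V.Δ := by
    rw [hS, WeierstrassCurve.variableChange_Δ]
  have hSc₆ : S.c₆ = ((T.u⁻¹ : ℤ_[3]ˣ) : ℤ_[3]) ^ 6 * V.c₆ := by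
    rw [hS, WeierstrassCurve.variableChange_c₆]
  have hvalSΔ : (addVal ℤ_[3] S.Δ).toNat = (addVal ℤ_[3] V.Δ).toNat := by
    rw [hSΔ, addVal_mul, addVal_pow, haddu]; simp
  have hvalSc₆ : (addVal ℤ_[3] S.c₆).toNat = (addVal ℤ_[3] V.c₆).toNat := by
    rw [hSc₆, addVal_mul, addVal_pow, haddu]; simp
  have hVΔ : ((V.Δ : ℤ_[3]) : ℚ_[3]) = (W.Δ : ℚ_[3]) := by
    have h := congrArg WeierstrassCurve.Δ hVmap
    rw [WeierstrassCurve.map_Δ, WeierstrassCurve.baseChange, WeierstrassCurve.map_Δ, eq_ratCast] at h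
    exact h
  have hVc₆ : ((V.c₆ : ℤ_[3]) : ℚ_[3]) = (W.c₆ : ℚ_[3]) := by
    have h := congrArg WeierstrassCurve.c₆ hVmap
    rw [WeierstrassCurve.map_c₆, WeierstrassCurve.baseChange, WeierstrassCurve.map_c₆, eq_ratCast] at h
    exact h
  have hWΔval : padicValRat 3 W.Δ = ((addVal ℤ_[3] S.Δ).toNat : ℤ) := by
    have h := congrArg Padic.valuation hVΔ
    rw [PadicInt.valuation_coe, Padic.valuation_ratCast] at h
    rw [hvalSΔ, addVal_toNat_eq_valuation]; exact h.symm
  have hWc₆val : padicValRat 3 W.c₆ = ((addVal ℤ_[3] S.c₆).toNat : ℤ) := by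
    have h := congrArg Padic.valuation hVc₆
    rw [PadicInt.valuation_coe, Padic.valuation_ratCast] at h
    rw [hvalSc₆, addVal_toNat_eq_valuation]; exact h.symm
  have hc₆0 : W.c₆ = 0 ↔ S.c₆ = 0 := by
    rw [hSc₆, mul_eq_zero, or_iff_right (pow_ne_zero _ (Units.ne_zero _)), ← PadicInt.coe_eq_zero, hVc₆,
      Rat.cast_eq_zero]
  have hlt : ∀ {m : ℕ}, ¬ (3 : ℤ_[3]) ^ m ∣ S.c₆ → S.c₆ ≠ 0 ∧ (addVal ℤ_[3] S.c₆).toNat < m := by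
    intro m hnd
    have hS0 : S.c₆ ≠ 0 := fun h ↦ hnd (by rw [h]; exact dvd_zero _)
    refine ⟨hS0, ?_⟩
    rw [pow_dvd_iff_le_addVal_of_irreducible h3i, not_le] at hnd
    have hne : addVal ℤ_[3] S.c₆ ≠ ⊤ := by rwa [Ne, addVal_eq_top_iff]
    rw [← ENat.coe_toNat hne] at hnd
    exact_mod_cast hnd
  have hge : ∀ {m : ℕ}, (3 : ℤ_[3]) ^ m ∣ S.c₆ → W.c₆ = 0 ∨ (m : ℤ) ≤ padicValRat 3 W.c₆ := by
    intro m hd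
    by_cases hc : W.c₆ = 0
    · exact Or.inl hc
    · have h := le_addVal_toNat_of_pow_dvd h3i (fun h ↦ hc (hc₆0.mpr h)) hd
      rw [hWc₆val]
      exact Or.inr (by exact_mod_cast h)
  -- roots of `Ψ₃`: `LocIrr W 3 ↔ (S ⊗ ℚ₃).Ψ₃` has no root in `ℚ₃`
  have hSmap : S.map ι = (T.map ι) • W.baseChange ℚ_[3] := by
    rw [hS, ← WeierstrassCurve.map_variableChange, hVmap]
  have hroots : LocIrr W 3 ↔ ∀ x : ℚ_[3], (S.map ι).Ψ₃.eval x ≠ 0 := by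
    change (W.baseChange ℚ_[3]).HasIrreducibleModPGaloisRep 3 ↔ _
    rw [WeierstrassCurve.hasIrreducibleModPGaloisRep_three_iff_forall_not_isRoot_Ψ₃]
    have e : (∃ x : ℚ_[3], (S.map ι).Ψ₃.eval x = 0) ↔ ∃ x : ℚ_[3], (W.baseChange ℚ_[3]).Ψ₃.eval x = 0 := by
      rw [hSmap]; exact exists_eval_Ψ₃_eq_zero_smul_iff _ _
    constructor
    · intro h x hx
      obtain ⟨y, hy⟩ := e.mp ⟨x, hx⟩
      exact h y hy
    · intro h x hx
      obtain ⟨y, hy⟩ := e.mpr ⟨x, hx⟩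
      exact h y hy
  rw [hroots]
  rcases hcases with ⟨h₂, h₄, h₄', h₆, hv⟩ | ⟨h₂, h₄, h₄', h₆, hv⟩
  · -- Kodaira `III`, `ord Δ = 3`
    have hΔ3 : padicValRat 3 W.Δ = 3 := by rw [hWΔval, hv]; norm_num
    by_cases h9 : (3 : ℤ_[3]) ^ 2 ∣ S.a₂
    · -- case B: no root, `ord c₆ ≥ 5`
      refine iff_of_true (tprime_caseB_forall_eval_Ψ₃_ne_zero S hA₁ hA₃ h9 h₄ h₄' h₆) ?_
      rcases hge (pow_five_dvd_c₆_of_mediumForm_III S hA₁ hA₃ h9 h₄ h₆) with hc | h5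
      · exact Or.inl hc
      · right
        rw [hΔ3]
        push_cast at h5
        omega
    · -- case A: a root, `ord c₆ = 3`
      obtain ⟨x, hx⟩ := tprime_caseA_exists_eval_Ψ₃_eq_zero_padic S hA₁ hA₃ h₂ h9 h₄ h₆
      refine iff_of_false (fun h ↦ h x hx) ?_
      obtain ⟨hS0, hlt4⟩ := hlt (not_pow_four_dvd_c₆_of_mediumForm_III h2 h3i S hA₁ hA₃ h₂ h9 h₄ h₆)
      have h3le := le_addVal_toNat_of_pow_dvd h3i hS0
        (pow_three_dvd_c₆_of_mediumForm_III S hA₁ hA₃ h₂ h₄ h₆)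
      have hc3 : padicValRat 3 W.c₆ = 3 := by
        rw [hWc₆val]
        have : (addVal ℤ_[3] S.c₆).toNat = 3 := by omega
        exact_mod_cast this
      rw [not_or, not_ne_iff]
      exact ⟨fun h ↦ hS0 (hc₆0.mp h), by rw [hc3, hΔ3]; norm_num⟩
  · -- Kodaira `III*`, `ord Δ = 9`
    have hΔ9 : padicValRat 3 W.Δ = 9 := by rw [hWΔval, hv]; norm_num
    by_cases h27 : (3 : ℤ_[3]) ^ 3 ∣ S.a₂
    · refine iff_of_true (tprime_caseB_forall_eval_Ψ₃_ne_zero_IIIstar S hA₁ hA₃ h27 h₄ h₄' h₆) ?_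
      rcases hge (pow_eight_dvd_c₆_of_mediumForm_IIIstar S hA₁ hA₃ h27 h₄ h₆) with hc | h8
      · exact Or.inl hc
      · right
        rw [hΔ9]
        push_cast at h8
        omega
    · obtain ⟨x, hx⟩ := tprime_caseA_exists_eval_Ψ₃_eq_zero_IIIstar S hA₁ hA₃ h₂ h27 h₄ h₆
      refine iff_of_false (fun h ↦ h x hx) ?_
      obtain ⟨hS0, hlt7⟩ :=
        hlt (not_pow_seven_dvd_c₆_of_mediumForm_IIIstar h2 h3i S hA₁ hA₃ h₂ h27 h₄ h₆)
      have h6le := le_addVal_toNat_of_pow_dvd h3i hS0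
        (pow_six_dvd_c₆_of_mediumForm_IIIstar S hA₁ hA₃ h₂ h₄ h₆)
      have hc6 : padicValRat 3 W.c₆ = 6 := by
        rw [hWc₆val]
        have : (addVal ℤ_[3] S.c₆).toNat = 6 := by omega
        exact_mod_cast this
      rw [not_or, not_ne_iff]
      exact ⟨fun h ↦ hS0 (hc₆0.mp h), by rw [hc6, hΔ9]; norm_num⟩

/-- **Every (t′) curve with `E[3]` reducible over `ℚ` (a rational `3`-isogeny; 5 127 of the 7 663 census classes)
is in CASE A**: `c₆ ≠ 0` and `2·ord₃ c₆ = ord₃ Δ + 3` (a `ℚ`-rational root of `Ψ₃` is a `ℚ₃`-rational one).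
[cite: Cremona1997, §3.8] -/
theorem tprime_caseA_of_not_hasIrreducibleModPGaloisRep_three (hadd : Addv W 3) (hsub : SubTprime W 3)
    (hred : ¬ W.HasIrreducibleModPGaloisRep 3) :
    W.c₆ ≠ 0 ∧ 2 * padicValRat 3 W.c₆ = padicValRat 3 W.Δ + 3 := by
  obtain ⟨x₀, hx₀⟩ := W.exists_isRoot_Ψ₃_of_not_hasIrreducibleModPGaloisRep_three hred
  have hloc : ¬ LocIrr W 3 := by
    change ¬ (W.baseChange ℚ_[3]).HasIrreducibleModPGaloisRep 3
    refine (W.baseChange ℚ_[3]).not_hasIrreducibleModPGaloisRep_three_of_isRoot_Ψ₃ (x₀ := (x₀ : ℚ_[3])) ?_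
    rw [Polynomial.IsRoot.def, WeierstrassCurve.baseChange, WeierstrassCurve.map_Ψ₃, eval_map,
      ← eq_ratCast (algebraMap ℚ ℚ_[3]), eval₂_hom, hx₀.eq_zero, map_zero]
  rw [tprime_locIrr_three_iff W hadd hsub, not_or, not_ne_iff] at hloc
  exact ⟨hloc.1, hloc.2⟩

/-- **Case A rows are off the Fouquet–Wan locus.** On a (t′) curve with `c₆ ≠ 0` and `2·ord₃ c₆ = ord₃ Δ + 3`
the local hypothesis `LocIrr W 3` of Fouquet–Wan 2021 Thm. 1.7 FAILS (the canonical subgroup is a `G_{ℚ₃}`-stable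
line); so the FW-locus stubs (KT 19981 `stub_lower_fwLocus`, K9) say nothing there — 6 605 of the 7 663 (t′) classes
with `N < 5·10⁵`, including every class with a rational `3`-isogeny. [cite: Cremona1997, §3.8] -/
theorem tprime_not_locIrr_three_of_caseA (hadd : Addv W 3) (hsub : SubTprime W 3) (hc : W.c₆ ≠ 0)
    (hA : 2 * padicValRat 3 W.c₆ = padicValRat 3 W.Δ + 3) : ¬ LocIrr W 3 := by
  rw [tprime_locIrr_three_iff W hadd hsub, not_or, not_ne_iff]
  exact ⟨hc, hA⟩

/-- **On the (t′) leaf the Fouquet–Wan claim shape needs no `ψ₃`-root finding.** For `W` on the (t′) rows of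
class `X4` in CASE B (`c₆ = 0 ∨ 2·ord₃ c₆ ≠ ord₃ Δ + 3`) with a non-split multiplicative prime `q ≠ 3` at which
`E[3]` is ramified, the CLAIM SHAPE `FouquetWanClaimShape KMC` (arXiv:2107.13726 Thm. 5.1 / 1.7, PRE, a displayed
hypothesis over the interface `KMC`, exactly as in `Additive/FouquetWanLocus.lean`) yields `KMC W 3` — its local
hypothesis `LocIrr W 3` being discharged by `tprime_locIrr_three_iff`. Census: 344 (t′) rank-`0` and 191 rank-`1`
`X4` classes (`N < 5·10⁵`; curve-1 test of the Steinberg prime). Nothing about Kato's objects or the preprint is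
asserted. [cite: FouquetWan2021, Thm. 1.7 (p. 5)] -/
theorem tprime_kmc_of_fouquetWanClaim_of_caseB
    {KMC : ∀ (W : WeierstrassCurve ℚ) [W.IsElliptic] [W.IsGloballyMinimal] (p : ℕ), Prop}
    (hFW : FouquetWanClaimShape KMC) (hadd : Addv W 3) (hsub : SubTprime W 3) (hX4 : ClassX4 W 3)
    (hB : W.c₆ = 0 ∨ 2 * padicValRat 3 W.c₆ ≠ padicValRat 3 W.Δ + 3) (hram : FWNonsplitRam W 3) :
    KMC W 3 :=
  hFW W 3 hX4 ((tprime_locIrr_three_iff W hadd hsub).mpr hB) hram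

end RatLevel

end Summit.BirchSwinnertonDyer.BirchSwinnertonDyer.Theorems.SolventPairLowerBound

end
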